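import Literature.NumberTheory.EllipticCurves.IwasawaAlgebraSpecializationSeparationProofs
import Literature.NumberTheory.EllipticCurves.LambdaAdicSelmerDataTorsionFreeProofs
import HarnessLib

/-!
# Non-vanishing of the specialised class `κ₁^{(q_m)}` for `m ≫ 0` from a FINITE KERNEL of the control map
# modulo `q_m` (no ambient `H¹(K,𝐓)`, no uniformity in `m`), and the `E`-side form on the `Λ`-adic Selmer
# module `𝔖_p(K_∞)` (proofs file)

Topic `NumberTheory/EllipticCurves`. THEOREMS ONLY (no definition, no named fact, no `sorry`, no instance, no
notation). Sequel of `IwasawaAlgebraSpecializationSeparationProofs` (bsd-idea-16 g6: §4 there controls the kernels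
of the specialisation maps `f_m : M → H_m` through an AMBIENT finitely generated module `M' ⊇ M` with
`ker f_m ⊆ M ∩ q_m M'` — for `𝔖 → H¹_{F_{q_m}}(K, T_{q_m})` that ambient module is `H¹(K, 𝐓)`, which the tree
does not have) and of `LambdaAdicSelmerDataTorsionFreeProofs` (this seat: `𝔖_p(K_∞)` is `Λ`-torsion-free
when `E(K)[p] = 0`). Written by the cell `pub/bsd-print-x9`, seat `bsd-line-x9-p2` (g3), for STUB 2 of the
shared μ-item of crux stmt-BirchSwinnertonDyer-27077 (clause «`κ.one ≠ 0` for all `m ≥ m₀`»).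

WHAT (`Λ = ℤ_p⟦X⟧`, `q_m = X^m + p`, `S_m = Λ/(q_m)`).
* §1 `not_X_pow_add_C_dvd_C_natCast` / `not_X_pow_add_C_dvd_natCast_pow`: `q_m ∤ p`, `q_m ∤ p^a` (`m ≥ 1`).
* §2 `exists_natCast_pow_smul_eq_zero_of_finite`: a FINITE `Λ`-module is killed by `p^a` (`a = v_p(#F)`; the
  prime-to-`p` part of `#F` is a unit of `ℤ_p ⊆ Λ`); hence (`exists_not_dvd_and_forall_smul_eq_zero_of_finite`)
  by an element `d = p^a` with `q_m ∤ d`.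
* §3 `exists_forall_smul_map_ne_zero_of_forall_exists_annihilator` — SEPARATION WITH A LEVEL-DEPENDENT
  ANNIHILATOR: if for every `m ≥ m₀` some `d_m ∈ Λ` with `q_m ∤ d_m` satisfies `f_m x = 0 ⇒ d_m • x ∈ q_m M`
  (the kernel of `f̄_m : M/q_m M → H_m` is `S_m`-torsion with a common annihilator), then a NON-TORSION `y ∈ M`
  (`M` finitely generated) has `λ • f_m y ≠ 0` whenever `q_m ∤ λ`, for all `m ≥ m₁` — `q_m` is prime, so
  `q_m ∤ d_m λ`, and §3 of the Separation file (`exists_forall_not_mem_smul_top_of_not_dvd`) applies to `d_m λ`.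
  Corollaries `exists_forall_map_ne_zero_…`, `exists_forall_map_ne_bot_…`.
* §4 `exists_annihilator_of_finite_ker_map_mkQ` — A FINITE KERNEL SUFFICES: if the image of `ker f` in `M/q_m M`
  is finite (equivalently, `Submodule.ker_liftQ`, the kernel of `f̄ : M/q_m M → H` is finite — the printed form
  of Howard's control theorem, Prop. 2.2.8 / Mazur–Rubin 5.3.13, AT ONE PRIME, no uniformity), then `d = p^a`
  works; `exists_forall_smul_map_ne_zero_of_finite_ker` and its corollaries combine §3–§4.
* §5 (`E`-side, `WeierstrassCurve.LambdaAdicSelmerData.…`) — for a pin `D` of `𝔖_p(K_∞)` with `E(K)[p] = 0`,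
  `γ` a topological generator and `𝔖` finitely generated (the letter's binder `Module.Finite Λ D.S`), a NON-ZERO
  `z ∈ 𝔖` and `Λ`-linear maps `f_m : 𝔖 → H_m` with finite kernels modulo `q_m` for `m ≥ m₀`:
  `exists_forall_smul_map_ne_zero_of_finite_ker` (`λ • f_m z ≠ 0` for `q_m ∤ λ`, `m ≥ m₁`),
  `exists_forall_map_ne_zero_of_finite_ker` (`f_m z ≠ 0`), `exists_forall_map_span_singleton_ne_bot_of_finite_ker`
  (`f_m(Λ ∙ z) = Λ ∙ f_m z ≠ ⊥` — with `stabilizedHeegnerModule D C = Λ ∙ κ_∞` (p642274) this is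
  `SpecWitness.map_le` with `κ₁ := f_m κ_∞ ≠ 0`), and the ambient variant `…_of_ker_le_comap` (kernel control
  through an injective `ι : 𝔖 → M'`, `M'` finitely generated).

WHY / PRINT. Howard 2004, proof of Thm. 2.2.10 (arXiv Thm. 3.2.10, p. 17): "It follows from Proposition
(control) and Lemma (torsion free) that `κ₁^{(𝔭)}` generates an infinite `S_𝔭`-submodule of `H¹_{F_𝔭}(K, T_𝔭)`
for all but finitely many height-one primes" and p. 18 "taking `𝔮 = T^m + p`": CONTROL enters only through the
FINITE KERNEL of `𝔖/𝔭𝔖 → H¹_{F_𝔭}(K, T_𝔭)` at the prime in question, TORSION-FREENESS through `y = κ_∞`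
non-torsion. §3–§5 are exactly this sentence in the tree's currency; the D1 lineage (S1 control) supplies the
finite kernels, this lineage supplied the torsion-freeness (p645741). HONEST FRAMING: module algebra plus
bookkeeping; no control theorem and no Kolyvagin system is constructed here; BSD is not proved by any of this; no
summit statement is proved by this seat.

References: [Howard2004HeegnerKolyvagin] B. Howard, Compositio Math. 140 (2004), Prop. 2.2.8 and proof of
Thm. 2.2.10; [MazurRubinMemoirs2004] Mem. AMS 799, Prop. 5.3.13–5.3.14; [GreenbergLNM1716] §4 p. 117;
[Washington1997] §7.1, §13.2 (`Λ`, `q_m` distinguished irreducible); [CastellaGrossiLeeSkinner2022] Rem. 4.1.4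
and §3.3.
-/

set_option autoImplicit false

noncomputable section

open scoped Classical Pointwise

namespace Literature.NumberTheory.EllipticCurves.IwasawaAlgebra

variable (p : ℕ) [hp : Fact p.Prime]

/-! ## §1 `q_m ∤ p^a` -/

/-- **`q_m = X^m + p` does not divide `p` in `Λ`** (`m ≥ 1`): from `C p = q_m · g` the constant coefficients
give `g₀ = 1` and the `X^m`-coefficients give `1 = -p · g_m`, making `p` a unit of `ℤ_p`.
[cite: Washington1997, §7.1 (q_m is a distinguished polynomial of degree m)] -/
theorem not_X_pow_add_C_dvd_C_natCast {m : ℕ} (hm : 1 ≤ m) :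
    ¬ (PowerSeries.X ^ m + PowerSeries.C (p : ℤ_[p]) : IwasawaAlgebra p) ∣
      (PowerSeries.C (p : ℤ_[p]) : IwasawaAlgebra p) := by
  rintro ⟨g, hg⟩
  have hm0 : m ≠ 0 := by omega
  have hp0 : (p : ℤ_[p]) ≠ 0 := Nat.cast_ne_zero.mpr hp.out.ne_zero
  -- constant coefficients: `p = p * g₀`, so `g₀ = 1`
  have h0 := congrArg (PowerSeries.constantCoeff (R := ℤ_[p])) hg
  rw [map_mul, map_add, map_pow, PowerSeries.constantCoeff_X, zero_pow hm0, zero_add,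
    PowerSeries.constantCoeff_C] at h0
  have hg0 : PowerSeries.constantCoeff g = 1 := by
    have h' : (p : ℤ_[p]) * (PowerSeries.constantCoeff g - 1) = 0 := by rw [mul_sub, ← h0, mul_one, sub_self]
    rcases mul_eq_zero.mp h' with h'' | h''
    · exact absurd h'' hp0
    · exact sub_eq_zero.mp h''
  -- `X^m`-coefficients: `0 = g₀ + p * g_m`... precisely `coeff m (C p) = 0 = coeff m (X^m g) + p * coeff m g`
  have h1 := congrArg (PowerSeries.coeff (R := ℤ_[p]) m) hg
  rw [PowerSeries.coeff_C, if_neg hm0, add_mul, map_add, PowerSeries.coeff_X_pow_mul', if_pos le_rfl,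
    Nat.sub_self, PowerSeries.coeff_zero_eq_constantCoeff_apply, hg0, PowerSeries.coeff_C_mul] at h1
  -- `1 + p * g_m = 0` makes `p` a unit
  have hunit : IsUnit (p : ℤ_[p]) :=
    IsUnit.of_mul_eq_one (-(PowerSeries.coeff m g)) (by linear_combination h1)
  exact (PadicInt.irreducible_p (p := p)).not_isUnit hunit

/-- **`q_m ∤ p^a` in `Λ`** (`m ≥ 1`; `q_m` is prime, `prime_X_pow_add_C`). [cite: Washington1997, §7.1 and §13.2 (Lemma 13.7)] -/
theorem not_X_pow_add_C_dvd_natCast_pow {m : ℕ} (hm : 1 ≤ m) (a : ℕ) :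
    ¬ (PowerSeries.X ^ m + PowerSeries.C (p : ℤ_[p]) : IwasawaAlgebra p) ∣ ((p : IwasawaAlgebra p) ^ a) := by
  intro h
  rw [← map_natCast (PowerSeries.C (R := ℤ_[p])) p] at h
  exact not_X_pow_add_C_dvd_C_natCast p hm ((prime_X_pow_add_C p hm).dvd_of_dvd_pow h)

/-! ## §2 A finite `Λ`-module is killed by a power of `p` -/

/-- **A finite `Λ`-module is killed by `p^a`**, `a = v_p(#F)`: `#F • y = 0`, `#F = p^a · u` with `p ∤ u`, and
`u` is a unit of `ℤ_p`, hence `C u` a unit of `Λ`. [cite: Washington1997, §13.2 (finite Λ-modules)] -/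
theorem exists_natCast_pow_smul_eq_zero_of_finite {F : Type*} [AddCommGroup F] [Module (IwasawaAlgebra p) F]
    [Finite F] : ∃ a : ℕ, ∀ y : F, ((p : IwasawaAlgebra p) ^ a) • y = 0 := by
  have hN : Nat.card F ≠ 0 := Nat.card_pos.ne'
  obtain ⟨a, u, hu, hN'⟩ := Nat.exists_eq_pow_mul_and_not_dvd hN p hp.out.ne_one
  refine ⟨a, fun y ↦ ?_⟩
  -- `u` is a unit of `ℤ_p`
  have hunit : IsUnit ((u : ℤ_[p])) := by
    rw [PadicInt.isUnit_iff]
    have hle := PadicInt.norm_le_one (u : ℤ_[p])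
    have hlt : ¬ ‖(u : ℤ_[p])‖ < 1 := by
      rw [← Int.cast_natCast, PadicInt.norm_int_lt_one_iff_dvd, Int.natCast_dvd_natCast]
      exact hu
    exact le_antisymm hle (not_lt.mp hlt)
  obtain ⟨w, hw⟩ := hunit.map (PowerSeries.C (R := ℤ_[p]))
  -- `w • (p^a • y) = #F • y = 0`
  have h1 : (w : IwasawaAlgebra p) • (((p : IwasawaAlgebra p) ^ a) • y) = 0 := by
    rw [hw, ← mul_smul, map_natCast, ← Nat.cast_pow, ← Nat.cast_mul, mul_comm, ← hN',
      Nat.cast_smul_eq_nsmul, card_nsmul_eq_zero']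
  calc ((p : IwasawaAlgebra p) ^ a) • y
      = ((↑w⁻¹ : IwasawaAlgebra p) * (w : IwasawaAlgebra p)) • (((p : IwasawaAlgebra p) ^ a) • y) := by
        rw [Units.inv_mul, one_smul]
    _ = 0 := by rw [mul_smul, h1, smul_zero]

/-- **A finite `Λ`-module has an annihilator prime to `q_m`** (`m ≥ 1`): `d = p^a` with `q_m ∤ d`.
[cite: Washington1997, §13.2] [cite: Howard2004HeegnerKolyvagin, proof of Thm. 2.2.10 (finite kernels at 𝔮 = T^m + p)] -/
theorem exists_not_dvd_and_forall_smul_eq_zero_of_finite {m : ℕ} (hm : 1 ≤ m) {F : Type*} [AddCommGroup F]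
    [Module (IwasawaAlgebra p) F] [Finite F] :
    ∃ d : IwasawaAlgebra p, ¬ (PowerSeries.X ^ m + PowerSeries.C (p : ℤ_[p]) : IwasawaAlgebra p) ∣ d ∧
      ∀ y : F, d • y = 0 := by
  obtain ⟨a, ha⟩ := exists_natCast_pow_smul_eq_zero_of_finite p (F := F)
  exact ⟨(p : IwasawaAlgebra p) ^ a, not_X_pow_add_C_dvd_natCast_pow p hm a, ha⟩

/-! ## §3 Separation with a level-dependent annihilator of the kernel -/

section Maps

variable {M : Type*} [AddCommGroup M] [Module (IwasawaAlgebra p) M]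
  {H : ℕ → Type*} [∀ m, AddCommGroup (H m)] [∀ m, Module (IwasawaAlgebra p) (H m)]

/-- **Non-vanishing (indeed `S_m`-torsion-freeness) of the specialised class from KERNELS KILLED BY `d_m`,
`q_m ∤ d_m`.** Let `M` be a finitely generated `Λ`-module, `f_m : M → H_m` (`m ≥ m₀`) `Λ`-linear with
`f_m x = 0 ⇒ d_m • x ∈ q_m M` for some `d_m` prime to `q_m`, and `y ∈ M` non-torsion. Then for all `m ≥ m₁`:
`λ • f_m y ≠ 0` whenever `q_m ∤ λ`. Proof: `λ • f_m y = 0` puts `λ • y` in `ker f_m`, so `(d_m λ) • y ∈ q_m M` with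
`q_m ∤ d_m λ` (`q_m` prime), contradicting `exists_forall_not_mem_smul_top_of_not_dvd` for `m ≥ m₁(y)`.
[cite: Howard2004HeegnerKolyvagin, proof of Thm. 2.2.10 ("κ₁^{(𝔭)} generates an infinite S_𝔭-submodule … for all but finitely many height-one primes"; 𝔮 = T^m + p)]
[cite: GreenbergLNM1716, §4 p. 117] -/
theorem exists_forall_smul_map_ne_zero_of_forall_exists_annihilator [Module.Finite (IwasawaAlgebra p) M]
    (f : ∀ m, M →ₗ[IwasawaAlgebra p] H m) {m₀ : ℕ}
    (hker : ∀ m, m₀ ≤ m → ∃ d : IwasawaAlgebra p,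
      ¬ (PowerSeries.X ^ m + PowerSeries.C (p : ℤ_[p]) : IwasawaAlgebra p) ∣ d ∧
        ∀ x : M, f m x = 0 → d • x ∈
          (PowerSeries.X ^ m + PowerSeries.C (p : ℤ_[p]) : IwasawaAlgebra p) •
            (⊤ : Submodule (IwasawaAlgebra p) M))
    {y : M} (hy : ∀ d : IwasawaAlgebra p, d ≠ 0 → d • y ≠ 0) :
    ∃ m₁ : ℕ, ∀ m, m₁ ≤ m → ∀ c : IwasawaAlgebra p,
      ¬ (PowerSeries.X ^ m + PowerSeries.C (p : ℤ_[p]) : IwasawaAlgebra p) ∣ c → c • f m y ≠ 0 := by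
  obtain ⟨m₁, hm₁⟩ := exists_forall_not_mem_smul_top_of_not_dvd p hy
  refine ⟨max m₀ (max m₁ 1), fun m hm c hc h0 ↦ ?_⟩
  have hm0 : m₀ ≤ m := le_of_max_le_left hm
  have hm1 : m₁ ≤ m := le_of_max_le_left (le_of_max_le_right hm)
  have hone : 1 ≤ m := le_of_max_le_right (le_of_max_le_right hm)
  obtain ⟨d, hd, hdk⟩ := hker m hm0
  refine hm₁ m hm1 (d * c) (fun hdvd ↦ ((prime_X_pow_add_C p hone).dvd_or_dvd hdvd).elim hd hc) ?_
  rw [mul_smul]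
  exact hdk _ (by rw [map_smul, h0])

/-- **`f_m y ≠ 0` for `m ≫ 0`** (the case `λ = 1`) from kernels killed by `d_m`, `q_m ∤ d_m`.
[cite: Howard2004HeegnerKolyvagin, proof of Thm. 2.2.10 (Σ_Λ; 𝔮 = T^m + p)] -/
theorem exists_forall_map_ne_zero_of_forall_exists_annihilator [Module.Finite (IwasawaAlgebra p) M]
    (f : ∀ m, M →ₗ[IwasawaAlgebra p] H m) {m₀ : ℕ}
    (hker : ∀ m, m₀ ≤ m → ∃ d : IwasawaAlgebra p,
      ¬ (PowerSeries.X ^ m + PowerSeries.C (p : ℤ_[p]) : IwasawaAlgebra p) ∣ d ∧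
        ∀ x : M, f m x = 0 → d • x ∈
          (PowerSeries.X ^ m + PowerSeries.C (p : ℤ_[p]) : IwasawaAlgebra p) •
            (⊤ : Submodule (IwasawaAlgebra p) M))
    {y : M} (hy : ∀ d : IwasawaAlgebra p, d ≠ 0 → d • y ≠ 0) :
    ∃ m₁ : ℕ, ∀ m, m₁ ≤ m → f m y ≠ 0 := by
  obtain ⟨m₁, hm₁⟩ := exists_forall_smul_map_ne_zero_of_forall_exists_annihilator p f hker hy
  refine ⟨max m₁ 1, fun m hm h0 ↦ hm₁ m (le_of_max_le_left hm) 1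
    (fun h ↦ not_isUnit_X_pow_add_C p (le_of_max_le_right hm) (isUnit_of_dvd_one h)) ?_⟩
  rw [one_smul, h0]

/-- **`f_m(L) ≠ 0` for `m ≫ 0`** for every submodule `L ∋ y`, from kernels killed by `d_m`, `q_m ∤ d_m`.
[cite: Howard2004HeegnerKolyvagin, proof of Thm. 2.2.10 (Σ_Λ; 𝔮 = T^m + p)] -/
theorem exists_forall_map_ne_bot_of_forall_exists_annihilator [Module.Finite (IwasawaAlgebra p) M]
    (f : ∀ m, M →ₗ[IwasawaAlgebra p] H m) {m₀ : ℕ}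
    (hker : ∀ m, m₀ ≤ m → ∃ d : IwasawaAlgebra p,
      ¬ (PowerSeries.X ^ m + PowerSeries.C (p : ℤ_[p]) : IwasawaAlgebra p) ∣ d ∧
        ∀ x : M, f m x = 0 → d • x ∈
          (PowerSeries.X ^ m + PowerSeries.C (p : ℤ_[p]) : IwasawaAlgebra p) •
            (⊤ : Submodule (IwasawaAlgebra p) M))
    {y : M} (hy : ∀ d : IwasawaAlgebra p, d ≠ 0 → d • y ≠ 0)
    (L : Submodule (IwasawaAlgebra p) M) (hyL : y ∈ L) :
    ∃ m₁ : ℕ, ∀ m, m₁ ≤ m → L.map (f m) ≠ ⊥ := by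
  obtain ⟨m₁, hm₁⟩ := exists_forall_map_ne_zero_of_forall_exists_annihilator p f hker hy
  refine ⟨m₁, fun m hm h ↦ hm₁ m hm ?_⟩
  rw [← Submodule.mem_bot (R := IwasawaAlgebra p), ← h]
  exact Submodule.mem_map_of_mem hyL

/-! ## §4 A finite kernel modulo `q_m` suffices -/

/-- **Finite kernel of `f̄ : M/q_m M → H` ⇒ an annihilator `d = p^a` prime to `q_m`**: if the image of
`ker f` in `M/q_m M` is finite (`m ≥ 1`), then `f x = 0 ⇒ p^a • x ∈ q_m M` for one `a`.
[cite: Howard2004HeegnerKolyvagin, Prop. 2.2.8 (control: finite kernel of H¹_{F_Λ}(K,𝐓)/𝔭 → H¹_{F_𝔭}(K,T_𝔭)) and proof of Thm. 2.2.10]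
[cite: MazurRubinMemoirs2004, Prop. 5.3.13–5.3.14] -/
theorem exists_annihilator_of_finite_ker_map_mkQ {m : ℕ} (hm : 1 ≤ m) {H₀ : Type*} [AddCommGroup H₀]
    [Module (IwasawaAlgebra p) H₀] (f : M →ₗ[IwasawaAlgebra p] H₀)
    (hfin : Finite ((LinearMap.ker f).map
      (((PowerSeries.X ^ m + PowerSeries.C (p : ℤ_[p]) : IwasawaAlgebra p) •
        (⊤ : Submodule (IwasawaAlgebra p) M)).mkQ))) :
    ∃ d : IwasawaAlgebra p, ¬ (PowerSeries.X ^ m + PowerSeries.C (p : ℤ_[p]) : IwasawaAlgebra p) ∣ d ∧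
      ∀ x : M, f x = 0 → d • x ∈
        (PowerSeries.X ^ m + PowerSeries.C (p : ℤ_[p]) : IwasawaAlgebra p) •
          (⊤ : Submodule (IwasawaAlgebra p) M) := by
  haveI := hfin
  obtain ⟨d, hd, hann⟩ := exists_not_dvd_and_forall_smul_eq_zero_of_finite p hm
    (F := (LinearMap.ker f).map
      (((PowerSeries.X ^ m + PowerSeries.C (p : ℤ_[p]) : IwasawaAlgebra p) •
        (⊤ : Submodule (IwasawaAlgebra p) M)).mkQ))
  refine ⟨d, hd, fun x hx ↦ ?_⟩
  have hxK : ((PowerSeries.X ^ m + PowerSeries.C (p : ℤ_[p]) : IwasawaAlgebra p) •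
      (⊤ : Submodule (IwasawaAlgebra p) M)).mkQ x ∈ (LinearMap.ker f).map
        (((PowerSeries.X ^ m + PowerSeries.C (p : ℤ_[p]) : IwasawaAlgebra p) •
          (⊤ : Submodule (IwasawaAlgebra p) M)).mkQ) :=
    Submodule.mem_map_of_mem (LinearMap.mem_ker.mpr hx)
  have h : d • (((PowerSeries.X ^ m + PowerSeries.C (p : ℤ_[p]) : IwasawaAlgebra p) •
      (⊤ : Submodule (IwasawaAlgebra p) M)).mkQ x) = 0 := congrArg Subtype.val (hann ⟨_, hxK⟩)
  rw [Submodule.mkQ_apply, ← Submodule.Quotient.mk_smul, Submodule.Quotient.mk_eq_zero] at h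
  exact h

/-- The same with the kernel of the LIFTED map `f̄ = liftQ f` (`q_m M ≤ ker f`, e.g. when `H` is killed by `q_m`):
`ker f̄ = (ker f).map mkQ` (`Submodule.ker_liftQ`). [cite: Howard2004HeegnerKolyvagin, Prop. 2.2.8] -/
theorem finite_ker_map_mkQ_of_finite_ker_liftQ {m : ℕ} {H₀ : Type*} [AddCommGroup H₀]
    [Module (IwasawaAlgebra p) H₀] (f : M →ₗ[IwasawaAlgebra p] H₀)
    (hle : ((PowerSeries.X ^ m + PowerSeries.C (p : ℤ_[p]) : IwasawaAlgebra p) •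
      (⊤ : Submodule (IwasawaAlgebra p) M)) ≤ LinearMap.ker f)
    (hfin : Finite (LinearMap.ker ((((PowerSeries.X ^ m + PowerSeries.C (p : ℤ_[p]) : IwasawaAlgebra p) •
      (⊤ : Submodule (IwasawaAlgebra p) M))).liftQ f hle))) :
    Finite ((LinearMap.ker f).map
      (((PowerSeries.X ^ m + PowerSeries.C (p : ℤ_[p]) : IwasawaAlgebra p) •
        (⊤ : Submodule (IwasawaAlgebra p) M)).mkQ)) := by
  rw [← Submodule.ker_liftQ _ f hle]
  exact hfin

/-- **Non-vanishing (`S_m`-torsion-freeness) of the specialised class from FINITE KERNELS modulo `q_m`.**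
`M` finitely generated, `f_m : M → H_m` (`m ≥ m₀`) with `(ker f_m).map mkQ_{q_m M}` finite, `y ∈ M` non-torsion:
for all `m ≥ m₁`, `λ • f_m y ≠ 0` whenever `q_m ∤ λ`. This is the first sentence of Howard's proof of Thm. 2.2.10
along the Eisenstein family, with control entering only through the finite kernel AT EACH PRIME (no uniformity).
[cite: Howard2004HeegnerKolyvagin, Prop. 2.2.8 and proof of Thm. 2.2.10 (𝔮 = T^m + p)]
[cite: MazurRubinMemoirs2004, Prop. 5.3.13–5.3.14] -/
theorem exists_forall_smul_map_ne_zero_of_finite_ker [Module.Finite (IwasawaAlgebra p) M]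
    (f : ∀ m, M →ₗ[IwasawaAlgebra p] H m) {m₀ : ℕ}
    (hker : ∀ m, m₀ ≤ m → Finite ((LinearMap.ker (f m)).map
      (((PowerSeries.X ^ m + PowerSeries.C (p : ℤ_[p]) : IwasawaAlgebra p) •
        (⊤ : Submodule (IwasawaAlgebra p) M)).mkQ)))
    {y : M} (hy : ∀ d : IwasawaAlgebra p, d ≠ 0 → d • y ≠ 0) :
    ∃ m₁ : ℕ, ∀ m, m₁ ≤ m → ∀ c : IwasawaAlgebra p,
      ¬ (PowerSeries.X ^ m + PowerSeries.C (p : ℤ_[p]) : IwasawaAlgebra p) ∣ c → c • f m y ≠ 0 :=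
  exists_forall_smul_map_ne_zero_of_forall_exists_annihilator p f (m₀ := max m₀ 1)
    (fun m hm ↦ exists_annihilator_of_finite_ker_map_mkQ p (le_of_max_le_right hm) (f m)
      (hker m (le_of_max_le_left hm))) hy

/-- **`f_m y ≠ 0` for `m ≫ 0`** from finite kernels modulo `q_m`.
[cite: Howard2004HeegnerKolyvagin, Prop. 2.2.8 and proof of Thm. 2.2.10 (𝔮 = T^m + p)] -/
theorem exists_forall_map_ne_zero_of_finite_ker [Module.Finite (IwasawaAlgebra p) M]
    (f : ∀ m, M →ₗ[IwasawaAlgebra p] H m) {m₀ : ℕ}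
    (hker : ∀ m, m₀ ≤ m → Finite ((LinearMap.ker (f m)).map
      (((PowerSeries.X ^ m + PowerSeries.C (p : ℤ_[p]) : IwasawaAlgebra p) •
        (⊤ : Submodule (IwasawaAlgebra p) M)).mkQ)))
    {y : M} (hy : ∀ d : IwasawaAlgebra p, d ≠ 0 → d • y ≠ 0) :
    ∃ m₁ : ℕ, ∀ m, m₁ ≤ m → f m y ≠ 0 :=
  exists_forall_map_ne_zero_of_forall_exists_annihilator p f (m₀ := max m₀ 1)
    (fun m hm ↦ exists_annihilator_of_finite_ker_map_mkQ p (le_of_max_le_right hm) (f m)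
      (hker m (le_of_max_le_left hm))) hy

/-- **`f_m(L) ≠ 0` for `m ≫ 0`** for every submodule `L ∋ y`, from finite kernels modulo `q_m`.
[cite: Howard2004HeegnerKolyvagin, Prop. 2.2.8 and proof of Thm. 2.2.10 (𝔮 = T^m + p)] -/
theorem exists_forall_map_ne_bot_of_finite_ker [Module.Finite (IwasawaAlgebra p) M]
    (f : ∀ m, M →ₗ[IwasawaAlgebra p] H m) {m₀ : ℕ}
    (hker : ∀ m, m₀ ≤ m → Finite ((LinearMap.ker (f m)).map
      (((PowerSeries.X ^ m + PowerSeries.C (p : ℤ_[p]) : IwasawaAlgebra p) •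
        (⊤ : Submodule (IwasawaAlgebra p) M)).mkQ)))
    {y : M} (hy : ∀ d : IwasawaAlgebra p, d ≠ 0 → d • y ≠ 0)
    (L : Submodule (IwasawaAlgebra p) M) (hyL : y ∈ L) :
    ∃ m₁ : ℕ, ∀ m, m₁ ≤ m → L.map (f m) ≠ ⊥ :=
  exists_forall_map_ne_bot_of_forall_exists_annihilator p f (m₀ := max m₀ 1)
    (fun m hm ↦ exists_annihilator_of_finite_ker_map_mkQ p (le_of_max_le_right hm) (f m)
      (hker m (le_of_max_le_left hm))) hy L hyL

end Maps

end Literature.NumberTheory.EllipticCurves.IwasawaAlgebra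

/-! ## §5 The `E`-side: a non-zero class of `𝔖_p(K_∞)` has non-zero specialisations for `m ≫ 0` -/

namespace WeierstrassCurve.LambdaAdicSelmerData

open Literature.NumberTheory.EllipticCurves Literature.NumberTheory.EllipticCurves.IwasawaAlgebra

universe u

variable {K : Type u} [Field K] [NumberField K] {V : WeierstrassCurve K} [V.IsElliptic] {p : ℕ}
  [hp : Fact p.Prime] {κ : ZpExtension K p} {γ : Field.absoluteGaloisGroup K} (D : V.LambdaAdicSelmerData κ γ)
  {H : ℕ → Type*} [∀ m, AddCommGroup (H m)] [∀ m, Module (IwasawaAlgebra p) (H m)]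

/-- **A non-zero `z ∈ 𝔖_p(K_∞)` has `S_m`-torsion-free specialisation for `m ≫ 0`** (`E(K)[p] = 0`, `γ` a
topological generator, `𝔖` finitely generated): for `Λ`-linear `f_m : 𝔖 → H_m` (`m ≥ m₀`) whose kernels have
finite image in `𝔖/q_m𝔖` (the finite kernel of Howard's control map at `𝔮 = q_m`), `λ • f_m z ≠ 0` whenever
`q_m ∤ λ`, for all `m ≥ m₁`. Non-torsion of `z` is `forall_smul_ne_zero_of_ne_zero'` (`𝔖` torsion-free, p645741).
[cite: Howard2004HeegnerKolyvagin, proof of Thm. 2.2.10 ("It follows from Proposition (control) and Lemma (torsion free) that κ₁^{(𝔭)} generates an infinite S_𝔭-submodule"; 𝔮 = T^m + p)] -/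
theorem exists_forall_smul_map_ne_zero_of_finite_ker (hγ : κ.IsTopGenerator γ)
    (hE : ∀ P : V.toAffine.Point, p • P = 0 → P = 0) [Module.Finite (IwasawaAlgebra p) D.S]
    (f : ∀ m, D.S →ₗ[IwasawaAlgebra p] H m) {m₀ : ℕ}
    (hker : ∀ m, m₀ ≤ m → Finite ((LinearMap.ker (f m)).map
      (((PowerSeries.X ^ m + PowerSeries.C (p : ℤ_[p]) : IwasawaAlgebra p) •
        (⊤ : Submodule (IwasawaAlgebra p) D.S)).mkQ)))
    {z : D.S} (hz : z ≠ 0) :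
    ∃ m₁ : ℕ, ∀ m, m₁ ≤ m → ∀ c : IwasawaAlgebra p,
      ¬ (PowerSeries.X ^ m + PowerSeries.C (p : ℤ_[p]) : IwasawaAlgebra p) ∣ c → c • f m z ≠ 0 :=
  IwasawaAlgebra.exists_forall_smul_map_ne_zero_of_finite_ker p f hker
    (D.forall_smul_ne_zero_of_ne_zero' hγ hE hz)

/-- **`f_m z ≠ 0` for all `m ≥ m₁`** (`z ≠ 0` in `𝔖_p(K_∞)`, finite kernels modulo `q_m`): the binder
`hone : κ.one ≠ 0` of the skeleton's composition `nonempty_specWitness_of_dvrConclusion` when `κ.one` is (the level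
family of) `f_m κ_∞`. [cite: Howard2004HeegnerKolyvagin, Prop. 2.2.8 and proof of Thm. 2.2.10 (𝔮 = T^m + p)] -/
theorem exists_forall_map_ne_zero_of_finite_ker (hγ : κ.IsTopGenerator γ)
    (hE : ∀ P : V.toAffine.Point, p • P = 0 → P = 0) [Module.Finite (IwasawaAlgebra p) D.S]
    (f : ∀ m, D.S →ₗ[IwasawaAlgebra p] H m) {m₀ : ℕ}
    (hker : ∀ m, m₀ ≤ m → Finite ((LinearMap.ker (f m)).map
      (((PowerSeries.X ^ m + PowerSeries.C (p : ℤ_[p]) : IwasawaAlgebra p) •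
        (⊤ : Submodule (IwasawaAlgebra p) D.S)).mkQ)))
    {z : D.S} (hz : z ≠ 0) :
    ∃ m₁ : ℕ, ∀ m, m₁ ≤ m → f m z ≠ 0 :=
  IwasawaAlgebra.exists_forall_map_ne_zero_of_finite_ker p f hker (D.forall_smul_ne_zero_of_ne_zero' hγ hE hz)

/-- **`f_m(Λ ∙ z) = Λ ∙ f_m z` with `f_m z ≠ 0`, for all `m ≥ m₁`** — the `SpecWitness.map_le` clause with
`κ₁ := f_m z` TOGETHER WITH `κ₁ ≠ 0`, for the cyclic module `Λ ∙ z` (with p642274's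
`stabilizedHeegnerModule D C = Λ ∙ κ_∞`: for `L = Λκ_∞(C)`).
[cite: CastellaGrossiLeeSkinner2022, Rem. 4.1.4] [cite: Howard2004HeegnerKolyvagin, proof of Thm. 2.2.10 (𝔮 = T^m + p)] -/
theorem exists_forall_map_span_singleton_of_finite_ker (hγ : κ.IsTopGenerator γ)
    (hE : ∀ P : V.toAffine.Point, p • P = 0 → P = 0) [Module.Finite (IwasawaAlgebra p) D.S]
    (f : ∀ m, D.S →ₗ[IwasawaAlgebra p] H m) {m₀ : ℕ}
    (hker : ∀ m, m₀ ≤ m → Finite ((LinearMap.ker (f m)).map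
      (((PowerSeries.X ^ m + PowerSeries.C (p : ℤ_[p]) : IwasawaAlgebra p) •
        (⊤ : Submodule (IwasawaAlgebra p) D.S)).mkQ)))
    {z : D.S} (hz : z ≠ 0) :
    ∃ m₁ : ℕ, ∀ m, m₁ ≤ m →
      (Submodule.span (IwasawaAlgebra p) {z}).map (f m) = Submodule.span (IwasawaAlgebra p) {f m z} ∧
        f m z ≠ 0 := by
  obtain ⟨m₁, hm₁⟩ := D.exists_forall_map_ne_zero_of_finite_ker hγ hE f hker hz
  exact ⟨m₁, fun m hm ↦ ⟨by rw [Submodule.map_span, Set.image_singleton], hm₁ m hm⟩⟩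

/-- **Ambient variant**: kernel control through an injective `Λ`-linear `ι : 𝔖 → M'` into a finitely
generated module (`f_m x = 0 ⇒ ι x ∈ q_m M'`, the cohomology-sequence form with `M' = H¹(K, 𝐓)`) and `z ≠ 0` give
`λ • f_m z ≠ 0` for `q_m ∤ λ`, `m ≥ m₁` (`IwasawaAlgebra.exists_forall_smul_map_ne_zero` with the non-torsion of
`ι z` from the torsion-freeness of `𝔖`). [cite: Howard2004HeegnerKolyvagin, proof of Thm. 2.2.10 (𝔮 = T^m + p)] -/
theorem exists_forall_smul_map_ne_zero_of_ker_le (hγ : κ.IsTopGenerator γ)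
    (hE : ∀ P : V.toAffine.Point, p • P = 0 → P = 0)
    {M' : Type*} [AddCommGroup M'] [Module (IwasawaAlgebra p) M'] [Module.Finite (IwasawaAlgebra p) M']
    (f : ∀ m, D.S →ₗ[IwasawaAlgebra p] H m) (ι : D.S →ₗ[IwasawaAlgebra p] M') (hι : Function.Injective ι)
    {m₀ : ℕ} (hker : ∀ m, m₀ ≤ m → ∀ x : D.S, f m x = 0 → ι x ∈
      (PowerSeries.X ^ m + PowerSeries.C (p : ℤ_[p]) : IwasawaAlgebra p) •
        (⊤ : Submodule (IwasawaAlgebra p) M'))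
    {z : D.S} (hz : z ≠ 0) :
    ∃ m₁ : ℕ, ∀ m, m₁ ≤ m → ∀ c : IwasawaAlgebra p,
      ¬ (PowerSeries.X ^ m + PowerSeries.C (p : ℤ_[p]) : IwasawaAlgebra p) ∣ c → c • f m z ≠ 0 :=
  IwasawaAlgebra.exists_forall_smul_map_ne_zero p f ι hker fun d hd h ↦
    D.forall_smul_ne_zero_of_ne_zero' hγ hE hz d hd (hι (by rw [map_smul, h, map_zero]))

end WeierstrassCurve.LambdaAdicSelmerData

end
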